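import Summits.Ventures.PackingBounds.Configurations.CCEKCode
import Summits.Ventures.PackingBounds.Configurations.D4Roots
import Literature.Geometry.DiscreteGeometry.KissingNumberFourUniqueness
import Literature.Geometry.DiscreteGeometry.KissingNumberFourProofs
import Mathlib.Analysis.Calculus.AbsolutelyMonotone
import Mathlib.Analysis.Calculus.IteratedDeriv.Lemmas
import Mathlib.Analysis.SpecificLimits.Basic

/-!
# The `D₄` root system is not universally optimal; no universally optimal 24-point code on `S³`

Framing: lottery ticket; floor = certified bounds/negative ranges. Venture `PackingBounds` (cell
`pub-packcert`, seat `pub-packcert-energy`) — the NEGATIVE side of the `(n, N) = (4, 24)` energy row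
(the cell's B4 table has the certified LP lower bounds for `24` points on `S³` strictly below the
24-cell's energies; this file says why no configuration can close that row the way `E₈` closes `(8, 240)`).

* `absolutelyMonotoneOn_one_add_pow`: `t ↦ (1+t)^k` is absolutely monotonic on `[-1,1)`.
* `CCEK.ckPow_energy_lt_D4`: for `8 ≤ k ≤ 13` the Cohn–Conway–Elkies–Kumar code `C_θ`,
  `tan(θ/2) = 35/11` (`CCEKCode.lean`), has strictly smaller `(1+t)^k`-energy than the `D₄` root system
  (Cohn–Conway–Elkies–Kumar 2007, Proposition 1, existence half, with ONE `θ` serving all six `k`;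
  `k = 8`: `5065.2160… < 5065.5`).
* `D4.not_universallyOptimal` (and the primed closed-form variant): **the `D₄` root system is NOT
  universally optimal** (CCEK 2007, §3) — the negation of the exact statement shape proved for `E₈`,
  the Leech lattice, the 600-cell, … in `Energy/UniversalOptimality.lean`.
* `inner_le_of_ckPow_optimal`: a configuration minimising every `(1+t)^k`-energy has minimal angle at
  least that of any competitor ("a universally optimal code is automatically optimal", CCEK §1).
* `no_universallyOptimal_card24`: **there is no universally optimal `24`-point configuration on
  `S³`** — conjectured by CCEK (2007, §1), settled in print by de Laat–Leijenhorst–de Muinck Keizer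
  (2024, §1) as the combination of their Theorem 5.3 (the `D₄` root system is the unique optimal
  kissing configuration of `ℝ⁴`) with CCEK. Here it is CONDITIONAL on the tree's named fact
  `Literature.Geometry.DiscreteGeometry.dlldmk2024_kissing_four_unique` (dLL–dMK Thm 5.3; by
  `KissingNumberFourUniqueness.lean` that fact is equivalent to their Lemma 5.1, the certified exact
  second-level Lasserre SDP computation, which is not formalised) — `no_universallyOptimal_card24_of_lemma51`
  is the same statement conditional on Lemma 5.1 verbatim. Everything else (Musin's `k(4) = 24` via the
  tree's kernel-checked certificate, the isometry bookkeeping, the energy comparison) is proved.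

## References
* H. Cohn, J. H. Conway, N. D. Elkies, A. Kumar, *The D₄ root system is not universally optimal*,
  Experiment. Math. 16 (2007) 313–320. [`CohnConwayElkiesKumar2007`]
* D. de Laat, N. Leijenhorst, W. H. H. de Muinck Keizer, *Optimality and uniqueness of the D₄ root
  system*, arXiv:2404.18794 (2024), §1, Lemma 5.1, Theorem 5.3. [`DeLaatLeijenhorstDeMuinckKeizer2024`]
* H. Cohn, A. Kumar, J. Amer. Math. Soc. 20 (2007) 99–148 (universal optimality). [`CohnKumar2006`]
-/

noncomputable section

namespace Summit.Ventures.PackingBounds.Config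

open Finset Set Literature.Geometry.DiscreteGeometry
open scoped ContDiff

/-! ### `(1+t)^k` is an admissible potential -/

/-- `t ↦ (1+t)^k` is absolutely monotonic on `[-1,1)` (its `n`-th derivative is
`k(k-1)⋯(k-n+1)(1+t)^{k-n} ≥ 0` for `t ≥ -1`). [folklore] -/
theorem absolutelyMonotoneOn_one_add_pow (k : ℕ) :
    AbsolutelyMonotoneOn (fun t : ℝ => (1 + t) ^ k) (Ico (-1) 1) := by
  refine AbsolutelyMonotoneOn.of_contDiff ((contDiff_const.add contDiff_id).pow k) fun n x hx => ?_
  have h := congrFun (iteratedDeriv_comp_const_add n (fun t : ℝ => t ^ k) 1) x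
  beta_reduce at h
  rw [h, iteratedDeriv_pow]
  have hx' : 0 ≤ 1 + x := by linarith [hx.1]
  positivity

/-- For unit vectors, `0 ≤ 1 + ⟪x, y⟫`. [folklore] -/
theorem one_add_inner_nonneg {n : ℕ} {x y : EuclideanSpace ℝ (Fin n)} (hx : ‖x‖ = 1) (hy : ‖y‖ = 1) :
    0 ≤ 1 + inner ℝ x y := by
  have h := abs_real_inner_le_norm x y
  rw [hx, hy, mul_one] at h
  linarith [(abs_le.1 h).1]

/-! ### The CCEK code beats `D₄` for `(1+t)^k`, `8 ≤ k ≤ 13` -/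

namespace CCEK

/-- **Cohn–Conway–Elkies–Kumar 2007, Proposition 1 (existence half), at the single parameter
`tan(θ/2) = 35/11`:** for every `k` with `8 ≤ k ≤ 13`, the code `C_θ` has strictly smaller
`(1+t)^k`-energy `Σ_{x ≠ y} (1 + ⟪x,y⟫)^k` than the `D₄` root system (24-cell). Exact values for `k = 8`:
`35883846737738528220517118714393889982620702908163 / 7084366470344828407815423444026036932857047044`
`= 5065.2160…` versus `10131/2 = 5065.5`; margins for `k = 9, …, 13`: `7.78…, 20.75…, 36.13…, 41.87…, 6.71…`.
[cite: CohnConwayElkiesKumar2007, Proposition 1] -/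
theorem ckPow_energy_lt_D4 (k : ℕ) (hk : 8 ≤ k) (hk' : k ≤ 13) :
    ∑ x ∈ CCEK.pts, ∑ y ∈ CCEK.pts.erase x, (1 + inner ℝ x y) ^ k <
      ∑ x ∈ D4.pts, ∑ y ∈ D4.pts.erase x, (1 + inner ℝ x y) ^ k := by
  rw [CCEK.energy_pts (fun t => (1 + t) ^ k), D4.energy_pts (fun t => (1 + t) ^ k)]
  interval_cases k <;> norm_num

/-- The `k = 8` instance with the `D₄` value written out: `E_{(1+t)⁸}(C_θ) < 5065.5 = E_{(1+t)⁸}(D₄)`.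
[cite: CohnConwayElkiesKumar2007, §3 (k = 8)] -/
theorem ckPow8_energy_lt :
    ∑ x ∈ CCEK.pts, ∑ y ∈ CCEK.pts.erase x, (1 + inner ℝ x y) ^ 8 < 10131 / 2 := by
  rw [CCEK.energy_pts (fun t => (1 + t) ^ 8)]
  norm_num

end CCEK

/-! ### `D₄` is not universally optimal -/

/-- **The `D₄` root system (24-cell) is not universally optimal** (Cohn–Conway–Elkies–Kumar 2007):
it is false that for every potential `a` absolutely monotonic on `[-1,1)` every `24`-point configuration
of unit vectors of `ℝ⁴` has `a`-energy at least that of the `D₄` root configuration `Config.D4.pts` —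
the code `C_θ` (`tan(θ/2) = 35/11`) has smaller `(1+t)⁸`-energy. (Compare the TRUE statements of this
exact shape for `E₈`, the Leech lattice, the 600-cell, … in `Energy/UniversalOptimality.lean`.)
[cite: CohnConwayElkiesKumar2007, §3 and Proposition 1] -/
theorem D4.not_universallyOptimal :
    ¬ ∀ a : ℝ → ℝ, AbsolutelyMonotoneOn a (Ico (-1) 1) →
      ∀ C : Finset (EuclideanSpace ℝ (Fin 4)), (∀ x ∈ C, ‖x‖ = 1) → C.card = 24 →
        ∑ x ∈ D4.pts, ∑ y ∈ D4.pts.erase x, a (inner ℝ x y) ≤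
          ∑ x ∈ C, ∑ y ∈ C.erase x, a (inner ℝ x y) := by
  intro h
  have h8 := h (fun t => (1 + t) ^ 8) (absolutelyMonotoneOn_one_add_pow 8) CCEK.pts CCEK.norm_pts
    CCEK.card_pts
  exact absurd (CCEK.ckPow_energy_lt_D4 8 (by norm_num) (by norm_num)) (not_lt.2 h8)

/-- **The `D₄` root system is not universally optimal**, closed form: it is false that every
`24`-point configuration of unit vectors of `ℝ⁴` has `a`-energy `≥ 24(a(-1) + 8a(-1/2) + 6a(0) + 8a(1/2))`
(the `D₄` value) for every `a` absolutely monotonic on `[-1,1)`.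
[cite: CohnConwayElkiesKumar2007, §3 and Proposition 1] -/
theorem D4.not_universallyOptimal' :
    ¬ ∀ a : ℝ → ℝ, AbsolutelyMonotoneOn a (Ico (-1) 1) →
      ∀ C : Finset (EuclideanSpace ℝ (Fin 4)), (∀ x ∈ C, ‖x‖ = 1) → C.card = 24 →
        (24 : ℝ) * (a (-1) + 8 * a (-1 / 2) + 6 * a 0 + 8 * a (1 / 2)) ≤
          ∑ x ∈ C, ∑ y ∈ C.erase x, a (inner ℝ x y) := by
  intro h
  refine D4.not_universallyOptimal fun a ha C h1 hN => ?_
  rw [D4.energy_pts a]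
  exact h a ha C h1 hN

/-! ### Universally optimal codes are optimal codes -/

/-- Crude upper bound: a configuration of unit vectors with pairwise inner products `≤ s` (`-1 ≤ s`) has
`(1+t)^k`-energy at most `|C|² (1+s)^k`. [folklore] -/
theorem ckPow_energy_le_card_sq {n : ℕ} (C : Finset (EuclideanSpace ℝ (Fin n)))
    (h1 : ∀ x ∈ C, ‖x‖ = 1) {s : ℝ} (hs1 : -1 ≤ s)
    (hs : ∀ x ∈ C, ∀ y ∈ C, x ≠ y → inner ℝ x y ≤ s) (k : ℕ) :
    ∑ x ∈ C, ∑ y ∈ C.erase x, (1 + inner ℝ x y) ^ k ≤ (C.card : ℝ) ^ 2 * (1 + s) ^ k := by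
  have hsk : 0 ≤ (1 + s) ^ k := pow_nonneg (by linarith) k
  have hin : ∀ x ∈ C, ∑ y ∈ C.erase x, (1 + inner ℝ x y) ^ k ≤ C.card * (1 + s) ^ k := by
    intro x hx
    calc ∑ y ∈ C.erase x, (1 + inner ℝ x y) ^ k ≤ ∑ y ∈ C.erase x, (1 + s) ^ k := by
          refine Finset.sum_le_sum fun y hy => ?_
          have hy' := Finset.mem_erase.1 hy
          exact pow_le_pow_left₀ (one_add_inner_nonneg (h1 x hx) (h1 y hy'.2))
            (by linarith [hs x hx y hy'.2 (Ne.symm hy'.1)]) k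
      _ = ((C.erase x).card : ℝ) * (1 + s) ^ k := by rw [Finset.sum_const, nsmul_eq_mul]
      _ ≤ C.card * (1 + s) ^ k :=
          mul_le_mul_of_nonneg_right (by exact_mod_cast Finset.card_erase_le (s := C) (a := x)) hsk
  calc ∑ x ∈ C, ∑ y ∈ C.erase x, (1 + inner ℝ x y) ^ k ≤ ∑ x ∈ C, (C.card : ℝ) * (1 + s) ^ k :=
        Finset.sum_le_sum hin
    _ = (C.card : ℝ) ^ 2 * (1 + s) ^ k := by rw [Finset.sum_const, nsmul_eq_mul]; ring

/-- A single ordered pair bounds the `(1+t)^k`-energy from below. [folklore] -/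
theorem ckPow_pair_le_energy {n : ℕ} (C : Finset (EuclideanSpace ℝ (Fin n)))
    (h1 : ∀ x ∈ C, ‖x‖ = 1) {x₀ y₀ : EuclideanSpace ℝ (Fin n)} (hx₀ : x₀ ∈ C) (hy₀ : y₀ ∈ C)
    (hne : x₀ ≠ y₀) (k : ℕ) :
    (1 + inner ℝ x₀ y₀) ^ k ≤ ∑ x ∈ C, ∑ y ∈ C.erase x, (1 + inner ℝ x y) ^ k := by
  classical
  have hy₀' : y₀ ∈ C.erase x₀ := Finset.mem_erase.2 ⟨hne.symm, hy₀⟩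
  calc (1 + inner ℝ x₀ y₀) ^ k ≤ ∑ y ∈ C.erase x₀, (1 + inner ℝ x₀ y) ^ k :=
        Finset.single_le_sum (f := fun y => (1 + inner ℝ x₀ y) ^ k)
          (fun y hy => pow_nonneg (one_add_inner_nonneg (h1 x₀ hx₀) (h1 y (Finset.mem_erase.1 hy).2)) k)
          hy₀'
    _ ≤ ∑ x ∈ C, ∑ y ∈ C.erase x, (1 + inner ℝ x y) ^ k :=
        Finset.single_le_sum (f := fun x => ∑ y ∈ C.erase x, (1 + inner ℝ x y) ^ k)
          (fun x hx => Finset.sum_nonneg fun y hy =>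
            pow_nonneg (one_add_inner_nonneg (h1 x hx) (h1 y (Finset.mem_erase.1 hy).2)) k) hx₀

/-- **A universally optimal code is an optimal spherical code** (Cohn–Conway–Elkies–Kumar 2007, §1:
"let `f(t) = (1+t)^N` for large `N`"): if `C₀` has `(1+t)^k`-energy at most that of `C` for every `k`,
and the distinct points of `C` have inner products `≤ s` (`-1 < s`), then so do the distinct points of
`C₀`. (No cardinality hypothesis is needed for this direction.) [cite: CohnConwayElkiesKumar2007, §1] -/
theorem inner_le_of_ckPow_optimal {n : ℕ} (C₀ C : Finset (EuclideanSpace ℝ (Fin n)))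
    (h₀ : ∀ x ∈ C₀, ‖x‖ = 1)
    (hopt : ∀ k : ℕ, ∑ x ∈ C₀, ∑ y ∈ C₀.erase x, (1 + inner ℝ x y) ^ k ≤
      ∑ x ∈ C, ∑ y ∈ C.erase x, (1 + inner ℝ x y) ^ k)
    (h1 : ∀ x ∈ C, ‖x‖ = 1) {s : ℝ} (hs1 : -1 < s)
    (hs : ∀ x ∈ C, ∀ y ∈ C, x ≠ y → inner ℝ x y ≤ s) :
    ∀ x ∈ C₀, ∀ y ∈ C₀, x ≠ y → inner ℝ x y ≤ s := by
  intro x₀ hx₀ y₀ hy₀ hne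
  by_contra hlt
  rw [not_le] at hlt
  set r : ℝ := (1 + inner ℝ x₀ y₀) / (1 + s) with hr
  have hs0 : 0 < 1 + s := by linarith
  have hr1 : 1 < r := by rw [hr, one_lt_div hs0]; linarith
  -- `r^k ≤ |C|²` for every `k`
  have hbound : ∀ k : ℕ, r ^ k ≤ (C.card : ℝ) ^ 2 := by
    intro k
    have h := (ckPow_pair_le_energy C₀ h₀ hx₀ hy₀ hne k).trans
      ((hopt k).trans (ckPow_energy_le_card_sq C h1 hs1.le hs k))
    rw [hr, div_pow, div_le_iff₀ (pow_pos hs0 k)]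
    exact h
  obtain ⟨k, hk⟩ := ((tendsto_pow_atTop_atTop_of_one_lt hr1).eventually_gt_atTop
    ((C.card : ℝ) ^ 2)).exists
  exact absurd (hbound k) (not_le.2 hk)

/-! ### Energies are isometry invariants -/

/-- The `a`-energy of a configuration is invariant under linear isometries. [folklore] -/
theorem energy_image_linearIsometryEquiv {n : ℕ} (S : Finset (EuclideanSpace ℝ (Fin n)))
    (Θ : EuclideanSpace ℝ (Fin n) ≃ₗᵢ[ℝ] EuclideanSpace ℝ (Fin n)) (a : ℝ → ℝ) :
    ∑ x ∈ S.image Θ, ∑ y ∈ (S.image Θ).erase x, a (inner ℝ x y) =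
      ∑ x ∈ S, ∑ y ∈ S.erase x, a (inner ℝ x y) := by
  classical
  rw [Finset.sum_image fun x _ y _ h => Θ.injective h]
  refine Finset.sum_congr rfl fun x _ => ?_
  rw [← Finset.image_erase Θ.injective S x, Finset.sum_image fun x _ y _ h => Θ.injective h]
  simp only [LinearIsometryEquiv.inner_map_map]

/-! ### The `D₄` configuration is a kissing configuration (public restatement of the kernel checks) -/

set_option maxRecDepth 100000 in
/-- Kernel check: the `D₄` lists have length `4` and squared length `2`. -/
theorem D4.shape_vecs_pub : shapeOK D4.vecs 4 (2 : ℤ) = true := by decide +kernel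

set_option maxRecDepth 100000 in
/-- Kernel check: the `D₄` distance distribution. -/
theorem D4.hist_vecs_pub : histOK D4.vecs D4.table D4.vecs = true := by decide +kernel

/-- Every point of `Config.D4.pts` is a unit vector. -/
theorem D4.norm_of_mem_pts : ∀ x ∈ D4.pts, ‖x‖ = 1 :=
  norm_eq_one (by simp) D4.shape_vecs_pub

/-- Distinct points of `Config.D4.pts` have inner product `≤ 1/2` (a kissing configuration). -/
theorem D4.inner_le_half_of_mem_pts : ∀ x ∈ D4.pts, ∀ y ∈ D4.pts, x ≠ y → inner ℝ x y ≤ 1 / 2 := by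
  refine inner_le (by simp) D4.shape_vecs_pub D4.hist_vecs_pub (1 / 2) fun p hp => ?_
  simp only [D4.table, List.mem_cons, List.not_mem_nil, or_false] at hp
  rcases hp with rfl | rfl | rfl | rfl <;> norm_num

/-! ### No universally optimal `24`-point configuration on `S³` -/

/-- **There is no universally optimal configuration of `24` points on `S³`** — conjectured by
Cohn–Conway–Elkies–Kumar (2007, §1) and obtained in print by de Laat–Leijenhorst–de Muinck Keizer (2024,
§1: "the combination of the `D₄` root system being the unique optimal spherical code, but not a
universally optimal spherical code, proves this conjecture"). CONDITIONAL on the named fact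
`dlldmk2024_kissing_four_unique` (dLL–dMK Theorem 5.3: every `24`-point kissing configuration of `ℝ⁴` is
an isometric image of the `D₄` root shell; not formalised — it rests on their certified exact Lasserre SDP,
Lemma 5.1). Proof: a universally optimal `C₀` minimises every `(1+t)^k`-energy, hence is a kissing
configuration (`inner_le_of_ckPow_optimal` against the 24-cell), hence isometric to `Config.D4.pts`, hence
has the `D₄` energies — but `C_θ` beats `D₄` for `(1+t)⁸`.
[cite: DeLaatLeijenhorstDeMuinckKeizer2024, §1 (no universally optimal 24-point code)] -/
theorem no_universallyOptimal_card24 (hU : dlldmk2024_kissing_four_unique) :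
    ¬ ∃ C₀ : Finset (EuclideanSpace ℝ (Fin 4)), (∀ x ∈ C₀, ‖x‖ = 1) ∧ C₀.card = 24 ∧
      ∀ a : ℝ → ℝ, AbsolutelyMonotoneOn a (Ico (-1) 1) →
        ∀ C : Finset (EuclideanSpace ℝ (Fin 4)), (∀ x ∈ C, ‖x‖ = 1) → C.card = 24 →
          ∑ x ∈ C₀, ∑ y ∈ C₀.erase x, a (inner ℝ x y) ≤
            ∑ x ∈ C, ∑ y ∈ C.erase x, a (inner ℝ x y) := by
  classical
  rintro ⟨C₀, h1, hN, hopt⟩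
  -- Step 1: `C₀` is a kissing configuration.
  have hkiss : ∀ x ∈ C₀, ∀ y ∈ C₀, x ≠ y → inner ℝ x y ≤ 1 / 2 :=
    inner_le_of_ckPow_optimal C₀ D4.pts h1
      (fun k => hopt _ (absolutelyMonotoneOn_one_add_pow k) D4.pts D4.norm_of_mem_pts D4.card_pts)
      D4.norm_of_mem_pts (by norm_num) D4.inner_le_half_of_mem_pts
  -- Step 2: `C₀` and the 24-cell are both isometric images of the `D₄` root shell.
  obtain ⟨Ψ, hΨ⟩ := hU C₀ hN h1 hkiss
  obtain ⟨Φ, hΦ⟩ := hU D4.pts D4.card_pts D4.norm_of_mem_pts D4.inner_le_half_of_mem_pts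
  have hroots : d4Roots = Φ.symm '' (D4.pts : Set (EuclideanSpace ℝ (Fin 4))) := by
    rw [hΦ, Set.image_image]
    simp
  have hC₀ : C₀ = D4.pts.image (Φ.symm.trans Ψ) := by
    apply Finset.coe_injective
    rw [Finset.coe_image, hΨ, hroots, Set.image_image]
    rfl
  -- Step 3: hence `C₀` has the `D₄` energies, contradicting the CCEK comparison at `(1+t)⁸`.
  have h8 := hopt (fun t => (1 + t) ^ 8) (absolutelyMonotoneOn_one_add_pow 8) CCEK.pts CCEK.norm_pts
    CCEK.card_pts
  have hE := energy_image_linearIsometryEquiv D4.pts (Φ.symm.trans Ψ) (fun t => (1 + t) ^ 8)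
  beta_reduce at hE
  rw [hC₀, hE] at h8
  exact absurd (CCEK.ckPow_energy_lt_D4 8 (by norm_num) (by norm_num)) (not_lt.2 h8)

/-- **No universally optimal `24`-point configuration on `S³`, conditional on dLL–dMK Lemma 5.1
verbatim** (if `C ⊆ S³` has `24` points and pairwise inner products `≤ 1/2` then all inner products of
distinct points lie in `{-1, -1/2, 0, 1/2}` — the statement their exact second-level Lasserre SDP
certifies): by the tree's `dlldmk2024_kissing_four_unique_of_rigidity` (Theorem 5.3 from Lemma 5.1,
proved) and `musin2008_kissing_four_holds` (`k(4) = 24`, kernel-checked certificate).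
[cite: DeLaatLeijenhorstDeMuinckKeizer2024, Lemma 5.1 and §1] -/
theorem no_universallyOptimal_card24_of_lemma51
    (h51 : ∀ C : Finset (EuclideanSpace ℝ (Fin 4)), C.card = 24 → (∀ x ∈ C, ‖x‖ = 1) →
      (∀ x ∈ C, ∀ y ∈ C, x ≠ y → inner ℝ x y ≤ 1 / 2) →
      ∀ x ∈ C, ∀ y ∈ C, x ≠ y →
        (inner ℝ x y = -1 ∨ inner ℝ x y = -1 / 2 ∨ inner ℝ x y = 0 ∨ inner ℝ x y = 1 / 2)) :
    ¬ ∃ C₀ : Finset (EuclideanSpace ℝ (Fin 4)), (∀ x ∈ C₀, ‖x‖ = 1) ∧ C₀.card = 24 ∧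
      ∀ a : ℝ → ℝ, AbsolutelyMonotoneOn a (Ico (-1) 1) →
        ∀ C : Finset (EuclideanSpace ℝ (Fin 4)), (∀ x ∈ C, ‖x‖ = 1) → C.card = 24 →
          ∑ x ∈ C₀, ∑ y ∈ C₀.erase x, a (inner ℝ x y) ≤
            ∑ x ∈ C, ∑ y ∈ C.erase x, a (inner ℝ x y) :=
  no_universallyOptimal_card24
    (dlldmk2024_kissing_four_unique_of_rigidity musin2008_kissing_four_holds h51)

end Summit.Ventures.PackingBounds.Config

end
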